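import Literature.AlgebraicGeometry.Morphisms.CechUnitCocycleResidueFibreClass
import Literature.AlgebraicGeometry.Morphisms.CechH1PullbackComp
import HarnessLib

/-!
# The difference class read on the fibre DIES ON A FACE where the two lifts agree: naturality of the Čech difference
# cochain under restriction to a subscheme (Görtz–Wedhorn II, Lemma 24.72 Step (I); Hartshorne DT Thm. 6.4 (b))

Layer `Literature/AlgebraicGeometry/Morphisms`, namespace `Literature.AlgebraicGeometry.Morphisms.CechUnitCocycle`.
THEOREMS ONLY (no definition, no named fact, no instance, no notation).  Cell `hodgecm-mathlib` (D-0151), F-2d road (R-def)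
«theorem of the cube over a non-reduced base by Artinian induction», Step (I) brick Č3 (author B-p07 (g15); sequel of ★ Č1
`CechUnitCocycleSmallExtensionResidue`, ★ Č2 `CechUnitCocycleResidueFibreClass`).

[GortzWedhorn2023] Lemma 24.72, proof, Step (I) (p. 409): the obstruction class in `H¹(X_s, 𝒪^r)` «maps to zero in
`⊕ᵢ H¹(X_{i,s}, 𝒪)` because `gᵢ^*𝓔` is trivial» — the class of the difference of two lifts restricts to the class of the
difference of the RESTRICTED lifts on a closed subscheme `Y ↪ X` (flat over the base), and vanishes there when the two lifts
agree on `Y`.  In the Čech currency of ★ `kunneth_cechH1_slices_injective` (`Morphisms.CechH1`, `cechComapH1`) this file records,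
for a morphism of `A`-schemes `jY : Y → X` (the face) and the unit cocycles `u, u'` over `R` with difference cochain `η` (Č1):

* §1 restriction of the models along `jY` (`Γ(X, V) ⊗_A R → Γ(Y, W) ⊗_A R`, `W ⊆ jY⁻¹V`: ★ `Sections.comap` ⊗ `id`, spelled
  inline): `comapR_resR`, `coef_comapR`, `comapR_kerMap` (naturality of the kernel map, ★ `map_kerMap`);
* §2 **`exists_ucocycle_comap`** — the restricted unit cocycles `u|_Y` on `jY⁻¹𝒰` exist (theorems only: `∃ uY, uY.val = …`);
  `sameRed_comap`; **`diffCochainK_comap`** — `η|_Y` (componentwise restriction) is a difference cochain of `(u|_Y, u'|_Y)`;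
* §3 fibre classes along ANY test morphism `φ : W → X` over `Spec k → Spec A` (Č2's construction with `(Z, g) := (W, φ)`):
  `bcSections_comm_comp_left` (`φ = h ≫ g`: the class along `φ` is `h^*` of the class along `g`, cochain level),
  `bcSections_comm_comp_right` (`φ = gW ≫ jY`: the class along `φ` is the class of `η|_Y` along `gW`), and the transport
  `fibreClass_congr_eq_zero_iff` along `φ = φ'`;
* §4 **`cechComapH1_fibreClass_eq_zero_of_rel_comap`** — THE FACE STEP: for a commutative square `hW ≫ g = gW ≫ jY`
  (`hW : W → Z` over `Spec k`, e.g. the fibre of the face), if `u|_Y` and `u'|_Y` are cohomologous by a `0`-cochain reducing to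
  `1` (both lifts trivial on the face, compatibly), then `hW^*[η^fibre] = 0` in `Ȟ¹(hW⁻¹g⁻¹𝒰, 𝒪_W)^d`.

HC_CM is proved only modulo the 7 printed citations until rung 0 closes; nothing here is about HC.

## References
* [GortzWedhorn2023] U. Görtz, T. Wedhorn, *Algebraic Geometry II* (2023), Lemma 24.72 proof Step (I) (p. 409), Lemma 26.15.
* [Hartshorne2010] R. Hartshorne, *Deformation Theory*, GTM 257 (2010), §6 Thm. 6.4 (b) and proof (pp. 50–51).
* [StacksProject] The Stacks Project, Tag 01ED (Čech cohomology, functoriality), Tag 02KH (degree `0`).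
-/

noncomputable section

universe u v

open TensorProduct CategoryTheory AlgebraicGeometry
open Literature.RingTheory.Flat Literature.RingTheory.Flat.IsSmallExtension

namespace Literature.AlgebraicGeometry.Morphisms

namespace CechUnitCocycle

variable {A : Type u} [CommRing A] {X Y : Scheme.{u}} {f : X ⟶ Spec (.of A)} {fY : Y ⟶ Spec (.of A)} {jY : Y ⟶ X}
  (hj : jY ≫ f = fY) {ι : Type v} {U : ι → X.Opens}

/-! ## §1 Restriction of the models along `jY : Y → X` -/

/-- `jY⁻¹U_i ∩ jY⁻¹U_j ⊆ jY⁻¹(U_i ∩ U_j)` (private plumbing). [folklore] -/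
private theorem pre₂ (jY : Y ⟶ X) (U : ι → X.Opens) (i j : ι) :
    preimageFamily jY U i ⊓ preimageFamily jY U j ≤ jY ⁻¹ᵁ (U i ⊓ U j) :=
  fun _ hx => hx

section ComapR

variable (R : Type u) [CommRing R] [Algebra A R]

/-- **Restriction of the models commutes with restriction of opens**: `(x|_{V'})|_Y = (x|_Y)|_{W'}`.
[cite: StacksProject, Tag 01ED (Cohomology, Section 20.9)] -/
theorem comapR_resR {V V' : X.Opens} {W W' : Y.Opens} (e : W ≤ jY ⁻¹ᵁ V) (e' : W' ≤ jY ⁻¹ᵁ V') (hV : V' ≤ V)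
    (hW : W' ≤ W) (x : Sections f V ⊗[A] R) :
    Algebra.TensorProduct.map (Sections.comap f fY jY hj e') (AlgHom.id A R) (resR f R hV x) =
      resR fY R hW (Algebra.TensorProduct.map (Sections.comap f fY jY hj e) (AlgHom.id A R) x) := by
  induction x using TensorProduct.induction_on with
  | zero => simp only [map_zero]
  | tmul s r =>
      rw [resR_tmul, Algebra.TensorProduct.map_tmul, Algebra.TensorProduct.map_tmul, resR_tmul, Sections.comap_res,
        Sections.res_comap]
  | add x y hx hy => simp only [map_add, hx, hy]

variable {R}

/-- **Restriction along `jY` commutes with change of coefficients** (`id ⊗ φ`).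
[cite: StacksProject, Tag 01ED (Cohomology, Section 20.9)] -/
theorem coef_comapR {R' : Type u} [CommRing R'] [Algebra A R'] (φ : R →ₐ[A] R') {V : X.Opens} {W : Y.Opens}
    (e : W ≤ jY ⁻¹ᵁ V) (x : Sections f V ⊗[A] R) :
    coef fY φ W (Algebra.TensorProduct.map (Sections.comap f fY jY hj e) (AlgHom.id A R) x) =
      Algebra.TensorProduct.map (Sections.comap f fY jY hj e) (AlgHom.id A R') (coef f φ V x) := by
  induction x using TensorProduct.induction_on with
  | zero => simp only [map_zero]
  | tmul s r => simp only [Algebra.TensorProduct.map_tmul, AlgHom.coe_id, id_eq]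
  | add x y hx hy => simp only [map_add, hx, hy]

/-- **Restriction along `jY` commutes with the kernel map** (★ `map_kerMap` along `Γ(X, V) → Γ(Y, W)`).
[cite: GortzWedhorn2023, Lemma 26.15] -/
theorem comapR_kerMap {k : Type u} [CommRing k] [Algebra A k] {I : Ideal R} {d : ℕ} (e₀ : (Fin d → k) ≃ₗ[A] I)
    {V : X.Opens} {W : Y.Opens} (e : W ≤ jY ⁻¹ᵁ V) (y : Fin d → Sections f V ⊗[A] k) :
    Algebra.TensorProduct.map (Sections.comap f fY jY hj e) (AlgHom.id A R) (kerMap e₀ (Sections f V) y) =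
      kerMap e₀ (Sections fY W) (fun ℓ => Algebra.TensorProduct.map (Sections.comap f fY jY hj e) (AlgHom.id A k) (y ℓ)) :=
  map_kerMap (e := e₀) (Sections f V) (Sections.comap f fY jY hj e) y

end ComapR

/-! ## §2 Restricted unit cocycles and their difference cochain -/

section Comap

variable {R R₀ k : Type u} [CommRing R] [CommRing R₀] [CommRing k] [Algebra A R] [Algebra A R₀] [Algebra A k]
  {π : R →ₐ[A] R₀} {ρ : R →ₐ[A] k} {I : Ideal R} {d : ℕ} {e : (Fin d → k) ≃ₗ[A] I}

/-- **The restriction `u|_Y` of a unit cocycle along `jY : Y → X` exists** as a unit cocycle on the preimage cover `jY⁻¹𝒰`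
(componentwise `Γ(U_i ∩ U_j) ⊗ R → Γ(jY⁻¹U_i ∩ jY⁻¹U_j) ⊗ R`; theorems only — the cocycle is produced inside the proof).
[cite: StacksProject, Tag 01ED (Cohomology, Section 20.9)] -/
theorem exists_ucocycle_comap (u : UCocycle f U R) :
    ∃ uY : UCocycle fY (preimageFamily jY U) R, ∀ i j, uY.val i j =
      Algebra.TensorProduct.map (Sections.comap f fY jY hj (pre₂ jY U i j)) (AlgHom.id A R) (u.val i j) := by
  refine ⟨⟨fun i j => Algebra.TensorProduct.map (Sections.comap f fY jY hj (pre₂ jY U i j)) (AlgHom.id A R) (u.val i j),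
    fun i j => (u.isUnit i j).map _, fun i j l => ?_⟩, fun i j => rfl⟩
  -- cocycle identity: restrict `u_{ij}| u_{jl}| = u_{il}|` along `jY`
  have h := congrArg (Algebra.TensorProduct.map
    (Sections.comap f fY jY hj (fun _ hx => hx : preimageFamily jY U i ⊓ preimageFamily jY U j ⊓ preimageFamily jY U l ≤
      jY ⁻¹ᵁ (U i ⊓ U j ⊓ U l))) (AlgHom.id A R)) (u.cocycle i j l)
  rw [map_mul] at h
  rw [← comapR_resR hj R _ _ (le12 (U := U) i j l) (le12 (U := preimageFamily jY U) i j l),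
    ← comapR_resR hj R _ _ (le23 (U := U) i j l) (le23 (U := preimageFamily jY U) i j l),
    ← comapR_resR hj R _ _ (le13 (U := U) i j l) (le13 (U := preimageFamily jY U) i j l)]
  exact h

/-- Restriction preserves «same reduction along `π`». [cite: GortzWedhorn2023, Lemma 26.15] -/
theorem sameRed_comap {u u' : UCocycle f U R} (hred : SameRed u u' π) {uY u'Y : UCocycle fY (preimageFamily jY U) R}
    (huY : ∀ i j, uY.val i j = Algebra.TensorProduct.map (Sections.comap f fY jY hj (pre₂ jY U i j)) (AlgHom.id A R) (u.val i j))
    (hu'Y : ∀ i j, u'Y.val i j =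
      Algebra.TensorProduct.map (Sections.comap f fY jY hj (pre₂ jY U i j)) (AlgHom.id A R) (u'.val i j)) :
    SameRed uY u'Y π := fun i j => by
  rw [huY, hu'Y, coef_comapR, coef_comapR, hred i j]

/-- **The restricted difference cochain**: if `η` is a difference cochain of `(u, u')` (Č1: `u'_{ij} = u_{ij}(1 + κ η_{ij})`), its
componentwise restriction `η|_Y` is a difference cochain of `(u|_Y, u'|_Y)`. [cite: GortzWedhorn2023, Lemma 26.15]
[cite: Hartshorne2010, §6 Thm. 6.4 (b) and proof (pp. 50–51)] -/
theorem diffCochainK_comap {u u' : UCocycle f U R} {uY u'Y : UCocycle fY (preimageFamily jY U) R}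
    (huY : ∀ i j, uY.val i j = Algebra.TensorProduct.map (Sections.comap f fY jY hj (pre₂ jY U i j)) (AlgHom.id A R) (u.val i j))
    (hu'Y : ∀ i j, u'Y.val i j =
      Algebra.TensorProduct.map (Sections.comap f fY jY hj (pre₂ jY U i j)) (AlgHom.id A R) (u'.val i j))
    (η : Fin d → (i j : ι) → Sections f (U i ⊓ U j) ⊗[A] k)
    (hη : ∀ i j, u'.val i j = u.val i j * (1 + kerMap e _ (fun ℓ => η ℓ i j))) (i j : ι) :
    u'Y.val i j = uY.val i j * (1 + kerMap e _ (fun ℓ =>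
      Algebra.TensorProduct.map (Sections.comap f fY jY hj (pre₂ jY U i j)) (AlgHom.id A k) (η ℓ i j))) := by
  rw [hu'Y, huY, hη i j, map_mul, map_add, map_one, comapR_kerMap hj]

end Comap

/-! ## §3 Fibre classes along a test morphism `φ : W → X` and their functoriality -/

section Test

variable {k : Type u} [CommRing k] [Algebra A k] {W Z : Scheme.{u}} {fW : W ⟶ Spec (.of k)} {fZ : Z ⟶ Spec (.of k)}

/-- **`φ = h ≫ g`: the fibre cochain along `φ` is `h^*` of the fibre cochain along `g`** (cochain level; `h : W → Z` over
`Spec k`, so that `h^*` is compatible with the `k`-structures). [cite: StacksProject, Tag 02KH (degree 0)]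
[cite: StacksProject, Tag 01ED (Cohomology, Section 20.9)] -/
theorem comap_bcSections_comm {g : Z ⟶ X} (hg : g ≫ f = restrictBase A fZ) {h : W ⟶ Z} (hh : h ≫ fZ = fW)
    {V : X.Opens} {T : Z.Opens} {T' : W.Opens} (e : T ≤ g ⁻¹ᵁ V) (e' : T' ≤ h ⁻¹ᵁ T) (x : Sections f V ⊗[A] k) :
    Sections.comap (restrictBase A fZ) (restrictBase A fW) h (by rw [restrictBase, ← Category.assoc, hh]) e'
        ((bcSections f fZ g hg e).comp (Algebra.TensorProduct.comm A (Sections f V) k).toAlgHom x) =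
      (bcSections f fW (h ≫ g) (by rw [Category.assoc, hg, restrictBase, ← Category.assoc, hh]) (e'.trans fun _ hx => e hx)).comp
        (Algebra.TensorProduct.comm A (Sections f V) k).toAlgHom x := by
  induction x using TensorProduct.induction_on with
  | zero => simp only [map_zero]
  | tmul s c =>
      rw [bcSections_comm_tmul, bcSections_comm_tmul, map_mul,
        Sections.comap_comp f (restrictBase A fZ) (restrictBase A fW) g h hg _ e e']
      congr 1
      -- `h^*(f_Z^*(c)|_T) = f_W^*(c)|_{T'}`: `h^*` is a `k`-algebra map
      exact (Sections.comap fZ fW h hh e').commutes c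
  | add x y hx hy => simp only [map_add, hx, hy]

/-- **`φ = gW ≫ jY`: the fibre cochain along `φ` of `η` is the fibre cochain along `gW` of the restriction `η|_Y`** (cochain
level). [cite: StacksProject, Tag 02KH (degree 0)] [cite: StacksProject, Tag 01ED (Cohomology, Section 20.9)] -/
theorem bcSections_comm_comap {gW : W ⟶ Y} (hgW : gW ≫ fY = restrictBase A fW) {V : X.Opens} {V' : Y.Opens} {T : W.Opens}
    (e : V' ≤ jY ⁻¹ᵁ V) (e' : T ≤ gW ⁻¹ᵁ V') (x : Sections f V ⊗[A] k) :
    (bcSections fY fW gW hgW e').comp (Algebra.TensorProduct.comm A (Sections fY V') k).toAlgHom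
        (Algebra.TensorProduct.map (Sections.comap f fY jY hj e) (AlgHom.id A k) x) =
      (bcSections f fW (gW ≫ jY) (by rw [Category.assoc, hj, hgW]) (e'.trans fun _ hx => e hx)).comp
        (Algebra.TensorProduct.comm A (Sections f V) k).toAlgHom x := by
  induction x using TensorProduct.induction_on with
  | zero => simp only [map_zero]
  | tmul s c =>
      rw [Algebra.TensorProduct.map_tmul, AlgHom.id_apply, bcSections_comm_tmul, bcSections_comm_tmul,
        Sections.comap_comp f fY (restrictBase A fW) jY gW hj hgW e e']
  | add x y hx hy => simp only [map_add, hx, hy]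

/-- **Transport of the vanishing of a fibre class along an equality of test morphisms `φ = φ'`** (the preimage covers
`φ⁻¹𝒰`, `φ'⁻¹𝒰` and the fibre cocycles then coincide). [cite: StacksProject, Tag 01ED (Cohomology, Section 20.9)] -/
theorem fibreClass_congr_eq_zero_iff {d : ℕ} {φ φ' : W ⟶ X} (eφ : φ = φ') (hφ : φ ≫ f = restrictBase A fW) (hφ' : φ' ≫ f = restrictBase A fW)
    (c : Fin d → (i j : ι) → Sections f (U i ⊓ U j) ⊗[A] k) (ℓ : Fin d)
    (hc : (fun i j => (bcSections f fW φ hφ (fun _ hx => hx : preimageFamily φ U i ⊓ preimageFamily φ U j ≤ φ ⁻¹ᵁ (U i ⊓ U j))).comp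
      (Algebra.TensorProduct.comm A (Sections f (U i ⊓ U j)) k).toAlgHom (c ℓ i j) : CechC1 (restrictBase A fW) (preimageFamily φ U)) ∈
        cechZ1 (restrictBase A fW) (preimageFamily φ U))
    (hc' : (fun i j => (bcSections f fW φ' hφ' (fun _ hx => hx : preimageFamily φ' U i ⊓ preimageFamily φ' U j ≤ φ' ⁻¹ᵁ (U i ⊓ U j))).comp
      (Algebra.TensorProduct.comm A (Sections f (U i ⊓ U j)) k).toAlgHom (c ℓ i j) : CechC1 (restrictBase A fW) (preimageFamily φ' U)) ∈
        cechZ1 (restrictBase A fW) (preimageFamily φ' U)) :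
    CechH1.mk (restrictBase A fW) (preimageFamily φ U) ⟨_, hc⟩ = 0 ↔
      CechH1.mk (restrictBase A fW) (preimageFamily φ' U) ⟨_, hc'⟩ = 0 := by
  subst eφ
  rfl

end Test

/-! ## §4 THE FACE STEP: the fibre class dies on a face where the lifts are cohomologous -/

section Face

variable {R R₀ k : Type u} [CommRing R] [CommRing R₀] [CommRing k] [Algebra A R] [Algebra A R₀] [Algebra A k]
  {π : R →ₐ[A] R₀} {ρ : R →ₐ[A] k} {I : Ideal R} {d : ℕ} {e : (Fin d → k) ≃ₗ[A] I}
  (H : IsSmallExtension π ρ I e) {ρ₀ : R₀ →ₐ[A] k} (hρ : ρ₀.comp π = ρ)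
  [∀ V : X.Opens, Module.Flat A (Sections f V)] [∀ V : Y.Opens, Module.Flat A (Sections fY V)]
  {Z W : Scheme.{u}} {fZ : Z ⟶ Spec (.of k)} {g : Z ⟶ X} (hg : g ≫ f = restrictBase A fZ)
  {fW : W ⟶ Spec (.of k)} {gW : W ⟶ Y} (hgW : gW ≫ fY = restrictBase A fW) {hW : W ⟶ Z} (hhW : hW ≫ fZ = fW)
  (hsq : hW ≫ g = gW ≫ jY)

include H hρ hj hgW hhW hsq in
/-- **THE FACE STEP** ([GortzWedhorn2023] Lemma 24.72 Step (I): the class «maps to zero in `H¹(X_{i,s}, 𝒪)` because `gᵢ^*𝓔`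
is trivial»): let `η` be a difference cochain of two lifts `(u, u')` over `R` on `X` (Č1) and `[η^fibre] ∈ Ȟ¹(g⁻¹𝒰, 𝒪_Z)^d` its
class on the fibre `g : Z → X` (Č2).  For a face `jY : Y → X` with fibre square `hW ≫ g = gW ≫ jY` (`hW : W → Z` over
`Spec k`): if the restricted lifts `u|_Y`, `u'|_Y` are cohomologous by a `0`-cochain reducing to `1` along `π` (e.g. both trivial
on the face, compatibly), then `hW^*[η^fibre_ℓ] = 0` in `Ȟ¹(hW⁻¹g⁻¹𝒰, 𝒪_W)` for every `ℓ`.  Proof: `hW^*` of the fibre cochain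
along `g` is the fibre cochain along `hW ≫ g = gW ≫ jY` (§3), which is the fibre cochain along `gW` of the difference cochain
`η|_Y` of `(u|_Y, u'|_Y)` (§2), whose class vanishes by Č2 `fibreClass_eq_zero_of_rel`.
[cite: GortzWedhorn2023, Lemma 24.72 proof Step (I) (p. 409)] [cite: Hartshorne2010, §6 Thm. 6.4 (b) and proof (pp. 50–51)]
(Edition note: the hypothesis `[∀ V : X.Opens, Module.Flat A (Sections f V)]` of this head holds when `A` is a field but is vacuous for a non-constant flat family `X/Spec A`; use `cechComapH1_fibreClass_eq_zero_of_rel_comap_of_isAffineOpen` of `CechUnitCocycleResidueAffineCover`, which assumes flatness of the sections over the affine opens of the cover only.) -/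
theorem cechComapH1_fibreClass_eq_zero_of_rel_comap (u u' : UCocycle f U R)
    (η : Fin d → (i j : ι) → Sections f (U i ⊓ U j) ⊗[A] k)
    (hη : ∀ i j, u'.val i j = u.val i j * (1 + kerMap e _ (fun ℓ => η ℓ i j)))
    {uY u'Y : UCocycle fY (preimageFamily jY U) R}
    (huY : ∀ i j, uY.val i j = Algebra.TensorProduct.map (Sections.comap f fY jY hj (pre₂ jY U i j)) (AlgHom.id A R) (u.val i j))
    (hu'Y : ∀ i j, u'Y.val i j =
      Algebra.TensorProduct.map (Sections.comap f fY jY hj (pre₂ jY U i j)) (AlgHom.id A R) (u'.val i j))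
    (h : (i : ι) → Sections fY (preimageFamily jY U i) ⊗[A] R) (h1 : ∀ i, coef fY π _ (h i) = 1) (hr : Rel uY u'Y h) (ℓ : Fin d) :
    cechComapH1 (restrictBase A fZ) (restrictBase A fW) hW (by rw [restrictBase, ← Category.assoc, hhW]) (preimageFamily g U)
      (CechH1.mk (restrictBase A fZ) (preimageFamily g U) ⟨_, bcSections_comm_mem_cechZ1 hg H hρ u u' η hη ℓ⟩) = 0 := by
  -- the restricted difference cochain and its fibre class along `gW`
  have hηY := diffCochainK_comap hj huY hu'Y η hη
  have h0 := fibreClass_eq_zero_of_rel (hg := hgW) H hρ uY u'Y h h1 hr _ hηY ℓ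
  -- `hW^*[η^fibre] = [fibre cochain along hW ≫ g]`
  have hφ : (hW ≫ g) ≫ f = restrictBase A fW := by rw [Category.assoc, hg, restrictBase, ← Category.assoc, hhW]
  have hφ' : (gW ≫ jY) ≫ f = restrictBase A fW := by rw [Category.assoc, hj, hgW]
  rw [cechComapH1_mk]
  have step1 : cechComapZ1 (restrictBase A fZ) (restrictBase A fW) hW (by rw [restrictBase, ← Category.assoc, hhW])
      (preimageFamily g U) ⟨_, bcSections_comm_mem_cechZ1 hg H hρ u u' η hη ℓ⟩ =
      ⟨_, bcSections_comm_mem_cechZ1 hφ H hρ u u' η hη ℓ⟩ := by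
    apply Subtype.ext
    rw [cechComapZ1_coe]
    funext i j
    rw [cechComapC1_apply]
    exact comap_bcSections_comm hg hhW _ _ (η ℓ i j)
  rw [step1]
  change CechH1.mk (restrictBase A fW) (preimageFamily (hW ≫ g) U) ⟨_, bcSections_comm_mem_cechZ1 hφ H hρ u u' η hη ℓ⟩ = 0
  rw [fibreClass_congr_eq_zero_iff hsq hφ hφ' η ℓ (bcSections_comm_mem_cechZ1 hφ H hρ u u' η hη ℓ)
    (bcSections_comm_mem_cechZ1 hφ' H hρ u u' η hη ℓ)]
  -- `[fibre cochain along gW ≫ jY of η] = [fibre cochain along gW of η|_Y] = 0`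
  have step2 : CechH1.mk (restrictBase A fW) (preimageFamily (gW ≫ jY) U)
      ⟨_, bcSections_comm_mem_cechZ1 hφ' H hρ u u' η hη ℓ⟩ =
      CechH1.mk (restrictBase A fW) (preimageFamily gW (preimageFamily jY U)) ⟨_, bcSections_comm_mem_cechZ1 hgW H hρ uY u'Y _ hηY ℓ⟩ := by
    congr 1
    apply Subtype.ext
    funext i j
    exact (bcSections_comm_comap hj hgW _ _ (η ℓ i j)).symm
  rw [step2]
  exact h0

end Face

end CechUnitCocycle

end Literature.AlgebraicGeometry.Morphisms

end
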